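import Summits.ResolutionOfSingularities.ResolutionOfSingularities.Theorems.FrobeniusClosingSteerCore4OrderOneExit
import HarnessLib

/-!
# Crux `Steer` (stmt-ResolutionOfSingularities-16345), line `switching_dichotomy`: RE-BASING AT A
# GENERATOR OVER A MEMBER OF THE POINT SEQUENCE, and the GENERATOR EXIT (pieces P2⁰ / P1 of the
# R1 phase machine, Theses-free bodies)

OURS (campaign `res-hironaka`, rung L, slot W4.1, chain W4.1, lead `res-L0-w41-lead-1` g3; replaces the
role of no printed item; NOT a statement of the manuscript under review). The chain planner's typed
sub-plan for the R1 residue of the registered skeleton r12 (`L/w41/Sketch-R1-phases.lean` v3, pieces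
`GenExit` (P1) and `Rebase` (P2)) reads, at every member `S = R M` of the point sequence of the base
along `O`, ALL generators `s'` of simple `S`-orders containing the radicand generator `t`
(`GenAt S p t s' := s' ^ p ∈ S ∧ t ∈ S[s']`). Both pieces rest on one bookkeeping fact, proved here
in its minimal honest form:

* `genRebase` — **every generator over every member re-bases the datum**: for `t ^ p ∈ A₀ ⊆ O` (`A₀`
  finitely generated, regular at the centre of `O`, `Frac (A₀[t]) = K`), the sequence `R` of quadratic
  transforms of the base along `O`, a stage `M` and `s'` with `s' ^ p ∈ R M`, `t ∈ (R M)[s']`, there is a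
  finitely generated `A' ⊇ A₀` inside `O` with `locAtCentre A' O = R M`, `s' ^ p ∈ A'`, `t ∈ A'[s']`,
  `Frac (A'[s']) = K`, regular at the centre of `O`; and a regular model for `(A', s')` is one for
  `(A₀, t)`. Proof: `R M = locAtCentre A₁ O` for a finitely generated model `A₀ ≤ A₁ ⊆ O`
  (`exists_model_of_sequence_member`); the finitely many unit denominators needed to write `t` and
  `s' ^ p` over `A₁[s']` are collected by induction over `Subring.closure` into ONE element `d ∈ A₁` of
  value `0`, and `A' := A₁[d⁻¹]` (still inside `R M`, so `locAtCentre A' O = R M` by idempotence);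
  regularity is read off `R M` (`isRegularLocalRing_sequence`, `isRegularLocalRing_locAtCentre_iff`).
  No step / multiplicity hypothesis on `s'` is needed for this (the planner's `Rebase` asked for the
  transfer of all fourteen core binders under `CanStepAt`; the composition only needs the re-based BASIC
  datum, the remaining binders being recovered by the landed range cascade of `Steer_of`).
* `genExit` — **P1, the generator exit**: if moreover `s'` is in ORDER-ONE FORM over `R M`
  (`s' ^ p − g ^ p` is a one-element part of a regular system of parameters of `R M` for some
  `g ∈ R M`), then `(A₀, t)` has a regular model: `genRebase`, then the LANDED `orderOneExit`
  (res-L0-w41-stub-3, p479657) for the re-based datum `(A', s')` along the shifted sequence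
  `i ↦ R (M + i)` with the one-term run at `N = 0`, then push down.

Vocabulary of the skeleton (`GenAt`, `OrderOneGen`, `ExitAt`, `Concl`) is UNFOLDED verbatim, so the
by-name leaves in the reshaped skeleton r13 are definitional. [cite: HeinzerEtAl2015, Prop. 4.4]
[cite: NovacoskiSpivakovsky2014, Lemma 2.5] [folklore]
-/

noncomputable section

-- `Summit.<S>.<S>.…` duplicates the summit name by design (single-problem summit).
set_option linter.dupNamespace false

open IsLocalRing

namespace Summit.ResolutionOfSingularities.ResolutionOfSingularities.Theorems.SwitchingDichotomy

open Literature.AlgebraicGeometry.Resolution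
open Summit.ResolutionOfSingularities.ResolutionOfSingularities.Theorems.PfaffLine
  (exists_model_of_sequence_member mem_valuationSubring_of_pow_mem
    adjoin_insert_toSubring_le le_adjoin_insert mem_adjoin_insert fg_adjoin_insert)

namespace GenExit

variable {k K : Type} [Field k] [Field K] [Algebra k K]

/-- **Clearing denominators over a simple order of a local ring at the centre.** Every element of
`(locAtCentre A₁ O)[s']` is `v / c` with `v ∈ A₁[s']` and `c ∈ A₁` of value `0` (`O.valuation c = 1`).
[folklore] -/
theorem exists_div_eq_of_mem_closure_insert (O : ValuationSubring K) (A₁ : Subalgebra k K) (s' : K)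
    {x : K} (hx : x ∈ Subring.closure (insert s' (locAtCentre A₁.toSubring O : Set K))) :
    ∃ v ∈ Algebra.adjoin k (insert s' (A₁ : Set K)), ∃ c ∈ A₁, O.valuation c = 1 ∧ x = v / c := by
  induction hx using Subring.closure_induction with
  | mem x hx =>
    rcases hx with rfl | hx
    · exact ⟨x, mem_adjoin_insert A₁ x, 1, A₁.one_mem, by simp, by simp⟩
    · obtain ⟨y, hy, z, hz, hv, rfl⟩ := mem_locAtCentre_iff.mp hx
      exact ⟨y, le_adjoin_insert A₁ s' hy, z, hz, hv, rfl⟩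
  | zero => exact ⟨0, Subalgebra.zero_mem _, 1, A₁.one_mem, by simp, by simp⟩
  | one => exact ⟨1, Subalgebra.one_mem _, 1, A₁.one_mem, by simp, by simp⟩
  | add x y _ _ hx hy =>
    obtain ⟨v₁, hv₁, c₁, hc₁, hvc₁, rfl⟩ := hx
    obtain ⟨v₂, hv₂, c₂, hc₂, hvc₂, rfl⟩ := hy
    have h₁ := ne_zero_of_valuation_eq_one hvc₁
    have h₂ := ne_zero_of_valuation_eq_one hvc₂
    refine ⟨v₁ * c₂ + v₂ * c₁, Subalgebra.add_mem _ (Subalgebra.mul_mem _ hv₁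
      (le_adjoin_insert A₁ s' hc₂)) (Subalgebra.mul_mem _ hv₂ (le_adjoin_insert A₁ s' hc₁)),
      c₁ * c₂, A₁.mul_mem hc₁ hc₂, by rw [map_mul, hvc₁, hvc₂, one_mul], ?_⟩
    field_simp
  | neg x _ hx =>
    obtain ⟨v, hv, c, hc, hvc, rfl⟩ := hx
    exact ⟨-v, Subalgebra.neg_mem _ hv, c, hc, hvc, by rw [neg_div]⟩
  | mul x y _ _ hx hy =>
    obtain ⟨v₁, hv₁, c₁, hc₁, hvc₁, rfl⟩ := hx
    obtain ⟨v₂, hv₂, c₂, hc₂, hvc₂, rfl⟩ := hy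
    exact ⟨v₁ * v₂, Subalgebra.mul_mem _ hv₁ hv₂, c₁ * c₂, A₁.mul_mem hc₁ hc₂,
      by rw [map_mul, hvc₁, hvc₂, one_mul], by rw [div_mul_div_comm]⟩

end GenExit

open GenExit

/-- **`genRebase` — every generator over every member of the point sequence re-bases the datum**
(piece P2 of the R1 phase machine in its minimal form; vocabulary unfolded). For `t ^ p ∈ A₀ ⊆ O`
with `A₀` finitely generated, regular at the centre of `O` and `Frac (A₀[t]) = K`, the sequence `R` of
quadratic transforms of the base along `O` (`R 0 = (A₀)_{𝔪_O ∩ A₀}`), a stage `M` and an element `s'`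
with `s' ^ p ∈ R M` and `t ∈ (R M)[s']`: there is a finitely generated `A' ⊇ A₀` inside `O` whose local
ring at the centre of `O` is `R M`, with `s' ^ p ∈ A'`, `t ∈ A'[s']`, `Frac (A'[s']) = K`, regular at
the centre; and every regular model of `(A', s')` is a regular model of `(A₀, t)`.
[cite: NovacoskiSpivakovsky2014, Lemma 2.5] [cite: Abhyankar1956Valuations, Prop. 8] [folklore] -/
theorem genRebase :
    ∀ (p : ℕ) (k K : Type) [Field k] [Field K] [Algebra k K]
      (O : ValuationSubring K) (A₀ : Subalgebra k K) (h₀ : A₀.toSubring ≤ O.toSubring) (t : K),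
      A₀.FG → t ^ p ∈ A₀ → IsFractionRing (Algebra.adjoin k (insert t (A₀ : Set K))) K →
      IsRegularLocalRing (Localization.AtPrime
        (Ideal.comap (Subring.inclusion h₀) (IsLocalRing.maximalIdeal O))) →
      ∀ R : ℕ → Subring K, R 0 = locAtCentre A₀.toSubring O →
        (∀ i, IsQuadraticTransformAlong O (R i) (R (i + 1))) →
        ∀ (M : ℕ) (s' : K), s' ^ p ∈ R M → t ∈ Subring.closure (insert s' (R M : Set K)) →
          ∃ (A' : Subalgebra k K) (h' : A'.toSubring ≤ O.toSubring), A₀ ≤ A' ∧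
            locAtCentre A'.toSubring O = R M ∧ A'.FG ∧ s' ^ p ∈ A' ∧
            t ∈ Algebra.adjoin k (insert s' (A' : Set K)) ∧
            IsFractionRing (Algebra.adjoin k (insert s' (A' : Set K))) K ∧
            IsRegularLocalRing (Localization.AtPrime
              (Ideal.comap (Subring.inclusion h') (IsLocalRing.maximalIdeal O))) ∧
            ((∃ (A : Subalgebra k K) (h : A.toSubring ≤ O.toSubring), A' ≤ A ∧ s' ∈ A ∧ A.FG ∧
                IsFractionRing A K ∧ IsRegularLocalRing (Localization.AtPrime
                  (Ideal.comap (Subring.inclusion h) (IsLocalRing.maximalIdeal O)))) →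
              ∃ (A : Subalgebra k K) (h : A.toSubring ≤ O.toSubring), A₀ ≤ A ∧ t ∈ A ∧ A.FG ∧
                IsFractionRing A K ∧ IsRegularLocalRing (Localization.AtPrime
                  (Ideal.comap (Subring.inclusion h) (IsLocalRing.maximalIdeal O)))) := by
  intro p k K _ _ _ O A₀ h₀ t hfg htp hfr hreg R hR0 hRq M s' hsp ht
  classical
  -- ### (1) `R M` is the local ring at the centre of a finitely generated model `A₀ ≤ A₁ ⊆ O`
  have hO : O.comap (RingHom.id K) = O := by
    ext x
    rfl
  have hS : A₀.toSubring.comap (RingHom.id K) = A₀.toSubring := by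
    ext x
    rfl
  obtain ⟨A₁, h₁, hle, hfg₁, -, hRM₁, -⟩ := exists_model_of_sequence_member k K K (RingHom.id K)
    O A₀ h₀ hfg (fun x _ => RingHom.mem_range.mpr ⟨x, rfl⟩) R (by rw [hO, hS]; exact hR0)
    (by rw [hO]; exact hRq) M
  have hRM : locAtCentre A₁.toSubring O = R M := by
    rw [← hRM₁]
    ext x
    rfl
  have hA₁R : A₁.toSubring ≤ R M := hRM ▸ le_locAtCentre A₁.toSubring O
  -- ### (2) the denominators: `t = v / c`, `s' ^ p = a / c₂` over `A₁[s']`, `A₁`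
  have ht' : t ∈ Subring.closure (insert s' (locAtCentre A₁.toSubring O : Set K)) := by
    rw [hRM]
    exact ht
  obtain ⟨v, hv, c, hc, hvc, htv⟩ := exists_div_eq_of_mem_closure_insert O A₁ s' ht'
  have hsp' : s' ^ p ∈ locAtCentre A₁.toSubring O := by
    rw [hRM]
    exact hsp
  obtain ⟨a, ha, c₂, hc₂, hvc₂, hsa⟩ := mem_locAtCentre_iff.mp hsp'
  have hc0 := ne_zero_of_valuation_eq_one hvc
  have hc20 := ne_zero_of_valuation_eq_one hvc₂
  -- one common unit denominator `d = c * c₂`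
  set d : K := c * c₂ with hd_def
  have hd : d ∈ A₁ := A₁.mul_mem hc hc₂
  have hvd : O.valuation d = 1 := by rw [hd_def, map_mul, hvc, hvc₂, one_mul]
  have hvdi : O.valuation d⁻¹ = 1 := by rw [map_inv₀, hvd, inv_one]
  have hdO : d⁻¹ ∈ O.toSubring := (O.valuation_le_one_iff _).mp hvdi.le
  have hdR : d⁻¹ ∈ R M := by
    have h := inv_mem_locAtCentre (le_locAtCentre A₁.toSubring O hd) hvd
    rwa [hRM] at h
  -- ### (3) the model `A' = A₁[d⁻¹]`
  set A' : Subalgebra k K := Algebra.adjoin k (insert d⁻¹ (A₁ : Set K)) with hA'_def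
  have h' : A'.toSubring ≤ O.toSubring := adjoin_insert_toSubring_le O.toSubring A₁ h₁ hdO
  have hA₁A' : A₁ ≤ A' := le_adjoin_insert A₁ d⁻¹
  have hdA' : d⁻¹ ∈ A' := mem_adjoin_insert A₁ d⁻¹
  have hA'R : A'.toSubring ≤ R M := adjoin_insert_toSubring_le (R M) A₁ hA₁R hdR
  have hRM' : locAtCentre A'.toSubring O = R M := by
    refine le_antisymm ?_ ?_
    · calc locAtCentre A'.toSubring O ≤ locAtCentre (R M) O := locAtCentre_mono O hA'R
        _ = R M := by rw [← hRM, locAtCentre_locAtCentre]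
    · rw [← hRM]
      exact locAtCentre_mono O fun x hx => hA₁A' hx
  -- `s' ^ p ∈ A'` and `t ∈ A'[s']`
  have hspA' : s' ^ p ∈ A' := by
    rw [hsa, show a / c₂ = a * c * (c * c₂)⁻¹ by field_simp]
    exact A'.mul_mem (A'.mul_mem (hA₁A' ha) (hA₁A' hc)) hdA'
  have htA' : t ∈ Algebra.adjoin k (insert s' (A' : Set K)) := by
    rw [htv, show v / c = v * c₂ * (c * c₂)⁻¹ by field_simp]
    exact Subalgebra.mul_mem _ (Subalgebra.mul_mem _
      (Algebra.adjoin_mono (Set.insert_subset_insert fun x hx => hA₁A' hx) hv)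
      (le_adjoin_insert A' s' (hA₁A' hc₂))) (le_adjoin_insert A' s' hdA')
  -- ### (4) fraction field and regularity at the centre
  haveI := hfr
  have hA₀A' : A₀ ≤ A' := hle.trans hA₁A'
  have hfr' : IsFractionRing (Algebra.adjoin k (insert s' (A' : Set K))) K :=
    isFractionRing_subalgebra_of_le (Algebra.adjoin k (insert t (A₀ : Set K))) _
      (Algebra.adjoin_le (Set.insert_subset htA' fun x hx => le_adjoin_insert A' s' (hA₀A' hx)))
  have hreg₀ : IsRegularLocalRing (R 0) := by
    rw [hR0]
    exact (isRegularLocalRing_locAtCentre_iff h₀).mpr hreg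
  have hregM : IsRegularLocalRing (R M) := isRegularLocalRing_sequence hreg₀ hRq M
  have hregA' : IsRegularLocalRing (locAtCentre A'.toSubring O) := by
    rw [hRM']
    exact hregM
  refine ⟨A', h', hA₀A', hRM', fg_adjoin_insert hfg₁ d⁻¹, hspA', htA', hfr',
    (isRegularLocalRing_locAtCentre_iff h').mp hregA', ?_⟩
  -- ### (5) push-down of regular models
  rintro ⟨A, h, hA'A, hsA, hfgA, hfrA, hregA⟩
  refine ⟨A, h, hA₀A'.trans hA'A, ?_, hfgA, hfrA, hregA⟩
  exact Algebra.adjoin_le (S := A) (Set.insert_subset hsA fun x hx => hA'A hx) htA'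

/-- **`genExit` — P1, the GENERATOR EXIT** (piece `GenExit` of the R1 phase machine; vocabulary
unfolded). For `t ^ p ∈ A₀ ⊆ O` as in `genRebase`, the sequence `R` of quadratic transforms of the
base along `O`, a stage `M` and a generator `s'` over `R M` (`s' ^ p ∈ R M`, `t ∈ (R M)[s']`) in
ORDER-ONE FORM — `s' ^ p − g ^ p` is a one-element part of a regular system of parameters of `R M` for
some `g ∈ R M` —, the datum `(A₀, t)` has a regular model: some finitely generated `A ⊇ A₀` with
`t ∈ A ⊆ O`, `Frac A = K`, regular at the centre of `O`. Proof: `genRebase`, the LANDED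
`orderOneExit` (p479657) for `(A', s')` along `i ↦ R (M + i)` at `N = 0`, push-down.
[cite: HeinzerEtAl2015, Prop. 4.4] [cite: Matsumura1987, Thm. 14.2] [folklore] -/
theorem genExit :
    ∀ p : ℕ, p.Prime → ∀ (k K : Type) [Field k] [CharP k p] [Field K] [Algebra k K]
      (O : ValuationSubring K) (A₀ : Subalgebra k K) (h₀ : A₀.toSubring ≤ O.toSubring) (t : K),
      A₀.FG → t ^ p ∈ A₀ → IsFractionRing (Algebra.adjoin k (insert t (A₀ : Set K))) K →
      IsRegularLocalRing (Localization.AtPrime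
        (Ideal.comap (Subring.inclusion h₀) (IsLocalRing.maximalIdeal O))) →
      ∀ R : ℕ → Subring K, R 0 = locAtCentre A₀.toSubring O →
        (∀ i, IsQuadraticTransformAlong O (R i) (R (i + 1))) →
        ∀ (M : ℕ) (s' : K), s' ^ p ∈ R M → t ∈ Subring.closure (insert s' (R M : Set K)) →
          (∃ g ∈ R M, ∃ (_ : IsLocalRing (R M)) (z : Fin 1 → R M), IsRsopPart z ∧
            ((z 0 : R M) : K) = s' ^ p - g ^ p) →
          ∃ (A : Subalgebra k K) (h : A.toSubring ≤ O.toSubring), A₀ ≤ A ∧ t ∈ A ∧ A.FG ∧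
            IsFractionRing A K ∧ IsRegularLocalRing (Localization.AtPrime
              (Ideal.comap (Subring.inclusion h) (IsLocalRing.maximalIdeal O))) := by
  intro p hp k K _ _ _ _ O A₀ h₀ t hfg htp hfr hreg R hR0 hRq M s' hsp ht hone
  obtain ⟨A', h', -, hRM', hfg', hsp', -, hfr', hreg', hpush⟩ :=
    genRebase p k K O A₀ h₀ t hfg htp hfr hreg R hR0 hRq M s' hsp ht
  apply hpush
  obtain ⟨g, hg, hloc, z, hz, hz0⟩ := hone
  refine orderOneExit p hp k K O A' h' s' hfg' hsp' hfr' hreg' (fun i => R (M + i))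
    (by simpa using hRM'.symm) (fun i => by simpa only [Nat.add_eq, Nat.add_assoc] using hRq (M + i))
    (fun _ => s') 0
    ⟨rfl, fun i hi => ?_, fun i hi => absurd hi (Nat.not_lt_zero i)⟩ ?_
  · obtain rfl : i = 0 := Nat.le_zero.mp hi
    simpa using hsp
  · exact ⟨g, hg, hloc, z, hz, hz0⟩

end Summit.ResolutionOfSingularities.ResolutionOfSingularities.Theorems.SwitchingDichotomy

end
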